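import Summits.Ventures.CertifiedQuantumChemistry.Rows.ModelPin
import HarnessLib

/-!
# Ventures/CertifiedQuantumChemistry — Rows/ModelPinFourfold.lean: the 4-FOLD symmetry rule of a DRESSED two-electron table
# (sibling of `Rows/ModelPin.lean`; nothing there is edited)

HONEST FRAMING (verbatim): certified bounds for a stated model Hamiltonian in a stated basis; not a
claim about the real molecule or material beyond that model. This file states ONE symmetry predicate and two
one-line implications; it certifies nothing and asserts nothing about any file.

WHY (chem-model-3 DESIGN-D7 ADDENDUM 14 (R1-3) «dressed-file symmetry rule», wave-4 W4-6 / W2 ROUTE R1; chem-ref-2 g21 INBOX l.6678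
2026-08-29T12:46Z: «an `IsFourfold` row will have a replayed certificate waiting» — W4-6 tranche (c), G₄-read instance RC.1122): a DRESSED
(similarity-transformed / folded) integral file carries a two-electron table with only the 4-FOLD permutational symmetry — `h` symmetric,
the joint transpose `(pq|rs) = (qp|sr)` and the pair exchange `(pq|rs) = (rs|pq)` — and NOT the separate `(pq|rs) = (qp|rs)` of the real
8-fold rule `Model.IsEightfold`. The row theorems of `Rows/SectorRows.lean` need only the minimal rule `Model.IsSymmetric` (Hermitian `H_F`),
which the 4-fold rule implies; so a cell on a G₄ file takes `(hF : F.IsFourfold)` where an 8-fold cell takes `(hF : F.IsEightfold)` and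
continues with `hF.isSymmetric` unchanged.

* `Model.IsFourfold` — the predicate (no `Decidable` instance, typer lint; it unfolds to decidable arithmetic on literal models);
* `Model.IsFourfold.isSymmetric` — 4-fold ⇒ `IsSymmetric`; `Model.IsEightfold.isFourfold` — 8-fold ⇒ 4-fold.

Typed by chem-type-07 (B8-1 slot 07, gen 13; statements-first, from the g12 staged draft) ahead of the first W4-6 (c) row.
-/

namespace Summit.Ventures.CertifiedQuantumChemistry

namespace Model

variable {k : ℕ}

/-- **4-fold symmetry rule of a DRESSED two-electron table** (chem-model-3 DESIGN-D7 ADDENDUM 14 (R1-3)): `h` symmetric, the joint transpose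
`(pq|rs) = (qp|sr)` and the pair exchange `(pq|rs) = (rs|pq)` — but NOT the separate `(pq|rs) = (qp|rs)` of the real 8-fold rule (a dressed /
similarity-transformed ERI need not have it). [cite: KnowlesHandy1989, §2 (FCIDUMP format)] -/
def IsFourfold (F : Model k) : Prop :=
  (∀ p q, F.h p q = F.h q p) ∧ (∀ p q r s, F.eri p q r s = F.eri q p s r) ∧ ∀ p q r s, F.eri p q r s = F.eri r s p q

/-- The 4-fold rule implies the minimal rule `Model.IsSymmetric` (so `H_F` is Hermitian and the (L)/(U) soundness theorems of `Rows/SectorRows.lean` apply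
verbatim to a dressed file). [cite: KnowlesHandy1989, §2 (FCIDUMP format)] -/
theorem IsFourfold.isSymmetric {F : Model k} (hF : F.IsFourfold) : F.IsSymmetric :=
  ⟨hF.1, hF.2.1⟩

/-- An 8-fold-symmetric table is 4-fold-symmetric (the joint transpose is the composite of the two separate index swaps of `Model.IsEightfold`).
[cite: KnowlesHandy1989, §2 (FCIDUMP format)] -/
theorem IsEightfold.isFourfold {F : Model k} (hF : F.IsEightfold) : F.IsFourfold :=
  ⟨hF.1, fun p q r s => (hF.2.1 p q r s).trans (hF.2.2.1 q p r s), hF.2.2.2⟩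

end Model

end Summit.Ventures.CertifiedQuantumChemistry
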